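/-
Copyright (c) 2026 the pub-hodgecm-mathlib formalisation cell (harness21).  Prover seat hodgecm-mathlib-K2E4-p03 (g2), Track B «K2-LIT» ∕ h413
(`stmt-HodgeConjecture-24833`), line `K2_E3_EllipticInputs`, unit U3, line U3-d: FILE C rung C1 — the TRANSVECTION class, DYADIC RESIDUAL part (b): THE COUNT at
PRINCIPAL LEVEL 2, valid at every residue characteristic.  2026-09-04.
-/
import Summits.HodgeConjecture.HodgeConjecture.Theorems.K2E3TransvectionCentralizerLevelTwo   -- (this seat, part (a)): `mem_levelTwo_iff`, `mem_heisBall_two_iff`, entry bookkeeping; brings ★ p855634 `K2E3TransvectionCentralizerLevel`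
import HarnessLib

/-!
# K2_E3 road (h413), U3-d FILE C, rung C1 «TRANSVECTION CLASS» — DYADIC RESIDUAL (b): THE COUNT `[C₂ : d(t) C₂ d(t)⁻¹] = [𝒪 : t𝒪]·[𝒪⁻ : t²𝒪⁻]` at PRINCIPAL LEVEL 2,
# WITHOUT `v 2 = 1` (Rogawski 1990 §3.9, Prop. 8.1.2 (b); Harish-Chandra 1999 Lemma 3.2)

Cell `pub/hodgecm-mathlib` (D-0151), Track B; U3-d acting assembly lead K2E3-p21 (g2) («part 2 = ‹C1 dyadic residual› → ‹SC-explicit›», 23:57:52Z); dealer K2E3-plan (g1).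
★ p855657 `K2E3TransvectionCentralizerIndex.relIndex_map_conj_torus_level` counts `[C : dCd⁻¹]` for the HYPERSPECIAL level under `v 2 = 1` (the coordinate `w = z + xσx∕2`
needs `2 ∈ 𝒪ˣ`).  Here `C₂ = Z_U(n(τ)) ∩ K(2)` (part (a) ★ `mem_levelTwo_iff`): `x ∈ 2𝒪` forces `v(xσx∕2) = v(x)²∕v 2 ≤ v 2`, so the SAME dévissage — torus removal
(★ `relIndex_eq_relIndex_of_coe_subset_mul`), the Heisenberg chain `B(v2, v2) ⊇ B(v2·vt, v2) ⊇ B(v2·vt, v2·vt²) = dC₂d⁻¹ ∩ B(v2, v2)` through `g ↦ g₀₁ ∈ 2𝒪` and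
`g ↦ g₀₂ mod 2t²𝒪 ∈ 2𝒪⁻ ∕ 2t²𝒪⁻` — gives `[C₂ : dC₂d⁻¹] = [2𝒪 : 2t𝒪]·[2𝒪⁻ : 2t²𝒪⁻] = [𝒪 : t𝒪]·[𝒪⁻ : t²𝒪⁻]` (★ `AddSubgroup.relIndex_map_map_of_injective` along `y ↦ 2y`)
for ANY `2 ≠ 0`: `relIndex_map_conj_torus_levelTwo`, and `relIndex_map_conj_torus_levelTwo_eq_sq` (`= Q²` in the letters `hF1 ∕ hF⁻` of K2E3-p21's index bridges).
THEOREMS ONLY; lane `--supports stmt-HodgeConjecture-24833 --as helper`.  HONEST LABEL: HC_CM is proved only modulo the 7 printed citations (2 remaining named inputs: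
hLiu418 = stmt-HodgeConjecture-24832, h413 = stmt-HodgeConjecture-24833) until rung 0 closes; count-neutral helper.

## References
* [Rogawski1990] J. D. Rogawski, *Automorphic Representations of Unitary Groups in Three Variables*, Ann. of Math. Stud. 123 (1990), §3.9 p. 32; §8.1 Prop. 8.1.2 (b) p. 114.
* [HarishChandra1999AdmissibleDistributions] Harish-Chandra, *Admissible Invariant Distributions on Reductive p-adic Groups*, ULS 16 (1999), §3.1 Lemma 3.2.
* [Rao1972] R. Ranga Rao, *Orbital integrals in reductive groups*, Ann. of Math. 96 (1972), Theorem.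
* [Serre1979] J.-P. Serre, *Local Fields*, GTM 67 (1979), Ch. II §3.
-/


set_option autoImplicit false
-- the mandated namespace repeats the single-problem summit's segment (`HodgeConjecture.HodgeConjecture`), as in every `Theorems/*.lean` of this sub-problem
set_option linter.dupNamespace false

noncomputable section

open Matrix
open scoped Matrix MatrixGroups Valued WithZero Pointwise
open Literature.NumberTheory.Automorphic Literature.NumberTheory.Automorphic.UnitaryGroup Literature.NumberTheory.Automorphic.HermitianLattice
open Literature.NumberTheory.Automorphic.UnitaryLatticeTree
open Summit.HodgeConjecture.HodgeConjecture.Cruxes.H413.K2E3TransvectionCentralizerLevel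

open Summit.HodgeConjecture.HodgeConjecture.Cruxes.H413.K2E3TransvectionCentralizerLevelTwo

namespace Summit.HodgeConjecture.HodgeConjecture.Cruxes.H413.K2E3TransvectionCentralizerLevelTwoIndex

variable {K : Type*} [Field K] (σ : K →+* K) [Valued K ℤᵐ⁰]

/-! ## §2 THE COUNT at principal level 2 -/

omit [Valued K ℤᵐ⁰] in
/-- `mulLeft a ∘ mulLeft b = mulLeft (a·b)`. [folklore] -/
theorem mulLeft_comp_mulLeft (a b : K) : (AddMonoidHom.mulLeft a).comp (AddMonoidHom.mulLeft b) = AddMonoidHom.mulLeft (a * b) := by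
  ext x; simp [mul_assoc]

/-- `y ∈ 2·(c·O) ⟺ v y ≤ v 2 · v c` for the unit ball `O`, `2 ≠ 0`, `c ≠ 0`. [cite: Serre1979, Ch. II §3] -/
theorem mem_map_map_mulLeft_iff {O : AddSubgroup K} (hO : ∀ x : K, x ∈ O ↔ Valued.v x ≤ 1) (h2 : (2 : K) ≠ 0) {c : K} (hc : c ≠ 0) (y : K) :
    y ∈ (O.map (AddMonoidHom.mulLeft c)).map (AddMonoidHom.mulLeft (2 : K)) ↔ Valued.v y ≤ Valued.v (2 : K) * Valued.v c := by
  rw [AddSubgroup.map_map, mulLeft_comp_mulLeft, mem_map_mulLeft_iff hO (mul_ne_zero h2 hc), Valuation.map_mul]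

/-- `2·O⁻` in coordinates: `σ y = −y ∧ v y ≤ v 2`. [cite: Serre1979, Ch. II §3] -/
theorem mem_map_mulLeft_two_skew_iff {O : AddSubgroup K} (hO : ∀ x : K, x ∈ O ↔ Valued.v x ≤ 1)
    {Om : AddSubgroup K} (hOm : ∀ x : K, x ∈ Om ↔ σ x = -x ∧ Valued.v x ≤ 1) (h2 : (2 : K) ≠ 0) (y : K) :
    y ∈ Om.map (AddMonoidHom.mulLeft (2 : K)) ↔ σ y = -y ∧ Valued.v y ≤ Valued.v (2 : K) := by
  rw [map_mulLeft_skew_eq_inf σ hO hOm h2 (map_ofNat σ 2) valued_v_two_le_one, AddSubgroup.mem_inf, mem_map_mulLeft_iff hO h2, hOm]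
  constructor
  · rintro ⟨hv, hσy, -⟩; exact ⟨hσy, hv⟩
  · rintro ⟨hσy, hv⟩; exact ⟨hv, hσy, hv.trans valued_v_two_le_one⟩

/-- **THE INDEX OF THE TORUS-CONJUGATE LEVEL AT PRINCIPAL LEVEL 2: `[C₂ : d(t) C₂ d(t)⁻¹] = [𝒪 : t𝒪]·[𝒪⁻ : t²𝒪⁻]`** for `C₂ = Z_U(n(τ)) ∩ K(2)` (`τ ≠ 0`), `d(t) = diag(t, 1, (σt)⁻¹)`
with `σ t = t`, `0 < v t ≤ 1`, `σ` an isometric involution and ONLY `2 ≠ 0` (every residue characteristic, every ramification): torus removal + the Heisenberg dévissage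
`B(v2, v2) ⊇ B(v2·vt, v2) ⊇ B(v2·vt, v2·vt²) = dC₂d⁻¹ ∩ B(v2, v2)` through `g ↦ g₀₁ ∈ 2𝒪` and `g ↦ g₀₂ mod 2t²𝒪 ∈ 2𝒪⁻ ∕ 2t²𝒪⁻` (the coordinate `w = z + xσx∕2` is integral
because `x ∈ 2𝒪`), then `[2𝒪 : 2t𝒪] = [𝒪 : t𝒪]`, `[2𝒪⁻ : 2t²𝒪⁻] = [𝒪⁻ : t²𝒪⁻]` along the injection `y ↦ 2y`. [cite: Rogawski1990, §3.9 p. 32; §8.1 Prop. 8.1.2 (b) p. 114]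
[cite: HarishChandra1999AdmissibleDistributions, §3.1 Lemma 3.2] [cite: Rao1972, Theorem] -/
theorem relIndex_map_conj_torus_levelTwo (hσ : ∀ a : K, σ (σ a) = a) (hσv : ∀ a : K, Valued.v (σ a) = Valued.v a) (h2 : (2 : K) ≠ 0)
    {τ t : K} (hτ : τ ≠ 0) (ht : t ≠ 0) (hσt : σ t = t) (hvt : Valued.v t ≤ 1)
    {u d : GL (Fin 3) K} (hu : (u : Matrix (Fin 3) (Fin 3) K) = !![1, 0, τ; 0, 1, 0; 0, 0, 1])
    (hd : (d : Matrix (Fin 3) (Fin 3) K) = Matrix.diagonal ![t, 1, (σ t)⁻¹]) (hd' : ((d⁻¹ : GL (Fin 3) K) : Matrix (Fin 3) (Fin 3) K) = Matrix.diagonal ![t⁻¹, 1, σ t])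
    {C : Subgroup (GL (Fin 3) K)} (hC : ∀ g : GL (Fin 3) K, g ∈ C ↔ g ∈ unitaryGroupOfForm σ ((StdForm.antidiagonal 3).over K) ∧ g * u = u * g ∧
      (∀ i j : Fin 3, Valued.v (((g : Matrix (Fin 3) (Fin 3) K) - 1) i j) ≤ Valued.v (2 : K)) ∧
      (∀ i j : Fin 3, Valued.v ((((g⁻¹ : GL (Fin 3) K) : Matrix (Fin 3) (Fin 3) K) - 1) i j) ≤ Valued.v (2 : K)))
    {O : AddSubgroup K} (hO : ∀ x : K, x ∈ O ↔ Valued.v x ≤ 1) {Om : AddSubgroup K} (hOm : ∀ x : K, x ∈ Om ↔ σ x = -x ∧ Valued.v x ≤ 1) :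
    (C.map (MulAut.conj d).toMonoidHom).relIndex C = (O.map (AddMonoidHom.mulLeft t)).relIndex O * (Om.map (AddMonoidHom.mulLeft (t * t))).relIndex Om := by
  classical
  have hσ2 : σ 2 = 2 := map_ofNat σ 2
  have h2le : Valued.v (2 : K) ≤ 1 := valued_v_two_le_one
  have hv20 : Valued.v (2 : K) ≠ 0 := (Valuation.ne_zero_iff _).2 h2
  have htt : t * t ≠ 0 := mul_ne_zero ht ht
  have hvt0 : Valued.v t ≠ 0 := (Valuation.ne_zero_iff _).2 ht
  have hvtt : Valued.v (t * t) ≤ 1 := by rw [Valuation.map_mul]; exact (mul_le_mul' hvt hvt).trans_eq (one_mul 1)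
  have hσtt : σ (t * t) = t * t := by rw [map_mul, hσt]
  have hinj2 : Function.Injective (AddMonoidHom.mulLeft (2 : K)) := fun a b hab => mul_right_injective₀ h2 (by simpa using hab)
  -- `v(x σx' / 2) ≤ v 2 · (r · r')` when `v x ≤ v2·r`, `v x' ≤ v2·r'`
  have hhalf : ∀ {x x' : K} {r r' : ℤᵐ⁰}, Valued.v x ≤ Valued.v (2 : K) * r → Valued.v x' ≤ Valued.v (2 : K) * r' →
      Valued.v (x * σ x' / 2) ≤ Valued.v (2 : K) * (r * r') := by
    intro x x' r r' hx hx'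
    rw [map_div₀, Valuation.map_mul, hσv, div_le_iff₀ (zero_lt_iff.2 hv20)]
    calc Valued.v x * Valued.v x' ≤ Valued.v (2 : K) * r * (Valued.v (2 : K) * r') := mul_le_mul' hx hx'
      _ = Valued.v (2 : K) * (r * r') * Valued.v (2 : K) := by simp only [mul_assoc, mul_comm, mul_left_comm]
  -- the three Heisenberg balls
  obtain ⟨B, hB⟩ := exists_subgroup_heisBall σ hσ hσv (r₁ := Valued.v (2 : K)) (r₂ := Valued.v (2 : K)) (mul_le_of_le_one_right' h2le)
  obtain ⟨B₁, hB₁⟩ := exists_subgroup_heisBall σ hσ hσv (r₁ := Valued.v (2 : K) * Valued.v t) (r₂ := Valued.v (2 : K))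
    (by calc Valued.v (2 : K) * Valued.v t * (Valued.v (2 : K) * Valued.v t) ≤ Valued.v (2 : K) * 1 * (1 * 1) :=
            mul_le_mul' (mul_le_mul' le_rfl hvt) (mul_le_mul' h2le hvt)
          _ = Valued.v (2 : K) := by rw [mul_one, mul_one, mul_one])
  have hr₂ : Valued.v (2 : K) * Valued.v t * (Valued.v (2 : K) * Valued.v t) ≤ Valued.v (2 : K) * (Valued.v t * Valued.v t) := by
    calc Valued.v (2 : K) * Valued.v t * (Valued.v (2 : K) * Valued.v t) = Valued.v (2 : K) * (Valued.v (2 : K) * (Valued.v t * Valued.v t)) := by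
          simp only [mul_comm, mul_left_comm]
      _ ≤ 1 * (Valued.v (2 : K) * (Valued.v t * Valued.v t)) := mul_le_mul' h2le le_rfl
      _ = _ := one_mul _
  obtain ⟨B₂, hB₂⟩ := exists_subgroup_heisBall σ hσ hσv (r₁ := Valued.v (2 : K) * Valued.v t) (r₂ := Valued.v (2 : K) * (Valued.v t * Valued.v t)) hr₂
  have hB₂B₁ : B₂ ≤ B₁ := fun g hg => by
    obtain ⟨x, z, hrel, hvx, hvz, hg⟩ := (hB₂ g).1 hg
    exact (hB₁ g).2 ⟨x, z, hrel, hvx, hvz.trans (mul_le_of_le_one_right' (by rw [← Valuation.map_mul]; exact hvtt)), hg⟩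
  have hB₁B : B₁ ≤ B := fun g hg => by
    obtain ⟨x, z, hrel, hvx, hvz, hg⟩ := (hB₁ g).1 hg
    exact (hB g).2 ⟨x, z, hrel, hvx.trans (mul_le_of_le_one_right' hvt), hvz, hg⟩
  have hBC : B ≤ C := fun g hg => ((mem_heisBall_two_iff σ hσ hσv hτ hu hC hB g).1 hg).1
  -- entries of `u(x, z)`
  have e01 : ∀ x z : K, (!![1, x, z; 0, 1, -σ x; 0, 0, 1] : Matrix (Fin 3) (Fin 3) K) 0 1 = x := fun x z => rfl
  have e02 : ∀ x z : K, (!![1, x, z; 0, 1, -σ x; 0, 0, 1] : Matrix (Fin 3) (Fin 3) K) 0 2 = z := fun x z => rfl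
  -- membership in `dCd⁻¹`
  set C₁ : Subgroup (GL (Fin 3) K) := C.map (MulAut.conj d).toMonoidHom with hC₁def
  have hmemC₁ : ∀ g : GL (Fin 3) K, g ∈ C₁ ↔ d⁻¹ * g * d ∈ C := fun g => by
    rw [hC₁def, Subgroup.mem_map_equiv, MulAut.conj_symm_apply]
  -- conjugating `u(x, z)` by `d⁻¹`
  have hconj : ∀ {g : GL (Fin 3) K} {x z : K}, (g : Matrix (Fin 3) (Fin 3) K) = !![1, x, z; 0, 1, -σ x; 0, 0, 1] →
      ((d⁻¹ * g * d : GL (Fin 3) K) : Matrix (Fin 3) (Fin 3) K) = !![1, t⁻¹ * x, (t * t)⁻¹ * z; 0, 1, -σ (t⁻¹ * x); 0, 0, 1] := by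
    intro g x z hg
    have hd₁ : ((d⁻¹ : GL (Fin 3) K) : Matrix (Fin 3) (Fin 3) K) = Matrix.diagonal ![t⁻¹, 1, (σ t⁻¹)⁻¹] := by rw [hd', map_inv₀, inv_inv, hσt]
    have hd₁' : (((d⁻¹)⁻¹ : GL (Fin 3) K) : Matrix (Fin 3) (Fin 3) K) = Matrix.diagonal ![(t⁻¹)⁻¹, 1, σ t⁻¹] := by rw [inv_inv, hd, map_inv₀, inv_inv, hσt]
    have h := coe_torusElt_conj_upperTriangularUnipotent σ (inv_ne_zero ht) hd₁ hd₁' hg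
    rw [inv_inv] at h
    rw [h, map_inv₀, hσt, map_mul, map_inv₀, hσt, mul_inv, mul_neg]
  -- `dCd⁻¹ ∩ B(v2, v2) = B(v2·vt, v2·vt²)`
  have hinf : C₁ ⊓ B = B₂ := by
    ext g
    rw [Subgroup.mem_inf, hmemC₁]
    constructor
    · rintro ⟨hgC, hgB⟩
      obtain ⟨x, z, hrel, -, -, hg⟩ := (hB g).1 hgB
      obtain ⟨-, -, hint, -⟩ := (hC _).1 hgC
      rw [hconj hg] at hint
      obtain ⟨-, hx, hz, -⟩ := v_le_of_forall_v_sub_one_apply_le hint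
      rw [Valuation.map_mul, map_inv₀] at hx
      rw [Valuation.map_mul, map_inv₀, Valuation.map_mul] at hz
      refine (hB₂ g).2 ⟨x, z, hrel, ?_, ?_, hg⟩
      · calc Valued.v x = Valued.v t * ((Valued.v t)⁻¹ * Valued.v x) := by rw [← mul_assoc, mul_inv_cancel₀ hvt0, one_mul]
          _ ≤ Valued.v t * Valued.v (2 : K) := mul_le_mul_right hx _
          _ = Valued.v (2 : K) * Valued.v t := mul_comm _ _
      · calc Valued.v z = Valued.v t * Valued.v t * ((Valued.v t * Valued.v t)⁻¹ * Valued.v z) := by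
              rw [← mul_assoc, mul_inv_cancel₀ (mul_ne_zero hvt0 hvt0), one_mul]
          _ ≤ Valued.v t * Valued.v t * Valued.v (2 : K) := mul_le_mul_right hz _
          _ = Valued.v (2 : K) * (Valued.v t * Valued.v t) := mul_comm _ _
    · intro hg₂
      obtain ⟨x, z, hrel, hvx, hvz, hg⟩ := (hB₂ g).1 hg₂
      refine ⟨(hC _).2 ((mem_levelTwo_iff σ hσ hσv hτ hu _).2 ⟨1, 1, t⁻¹ * x, (t * t)⁻¹ * z, by rw [map_one, one_mul], by rw [map_one, one_mul],
        by rw [sub_self, map_zero]; exact zero_le, by rw [sub_self, map_zero]; exact zero_le, ?_, ?_, ?_, ?_⟩), hB₁B (hB₂B₁ hg₂)⟩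
      · rw [map_mul, map_mul, map_inv₀, map_inv₀, hσt, hσtt]
        field_simp
        linear_combination hrel
      · rw [Valuation.map_mul, map_inv₀]
        calc (Valued.v t)⁻¹ * Valued.v x ≤ (Valued.v t)⁻¹ * (Valued.v (2 : K) * Valued.v t) := mul_le_mul_right hvx _
          _ = Valued.v (2 : K) := by field_simp
      · rw [Valuation.map_mul, map_inv₀, Valuation.map_mul]
        calc (Valued.v t * Valued.v t)⁻¹ * Valued.v z ≤ (Valued.v t * Valued.v t)⁻¹ * (Valued.v (2 : K) * (Valued.v t * Valued.v t)) := mul_le_mul_right hvz _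
          _ = Valued.v (2 : K) := by field_simp
      · rw [diagonal_one_one_one, Matrix.one_mul, hconj hg]
  -- torus removal: `C ⊆ B(v2, v2) · dCd⁻¹`
  have hcover : (C : Set (GL (Fin 3) K)) ⊆ (B : Set (GL (Fin 3) K)) * (C₁ : Set (GL (Fin 3) K)) := by
    intro g hgC
    obtain ⟨α, β, x, z, hα, hβ, hvα1, hvβ1, hrel, hvx, hvz, hg⟩ := (mem_levelTwo_iff σ hσ hσv hτ hu g).1 ((hC g).1 hgC)
    have hα0 : α ≠ 0 := right_ne_zero_of_mul_eq_one hα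
    have hβ0 : β ≠ 0 := right_ne_zero_of_mul_eq_one hβ
    obtain ⟨m, hm, hm'⟩ := exists_units_coe_eq_torusS (K := K) hα0 hβ0
    -- `m ∈ C` and `m = d m d⁻¹ ∈ C₁`
    have hmC : m ∈ C := (hC m).2 ((mem_levelTwo_iff σ hσ hσv hτ hu m).2 ⟨α, β, 0, 0, hα, hβ, hvα1, hvβ1, by simp, by rw [map_zero]; exact zero_le,
      by rw [map_zero]; exact zero_le, by rw [hm, map_zero, neg_zero]; ext i j; fin_cases i <;> fin_cases j <;> simp [Matrix.mul_apply, Fin.sum_univ_three]⟩)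
    have hdm : d⁻¹ * m * d = m := by
      have hc : d * m = m * d := Units.ext (by
        rw [Units.val_mul, Units.val_mul, hd, hm, Matrix.diagonal_mul_diagonal, Matrix.diagonal_mul_diagonal]
        congr 1; funext i; fin_cases i <;> simp [mul_comm])
      rw [mul_assoc, ← hc, ← mul_assoc, inv_mul_cancel, one_mul]
    have hmC₁ : m ∈ C₁ := (hmemC₁ m).2 (by rw [hdm]; exact hmC)
    refine Set.mem_mul.2 ⟨g * m⁻¹, ?_, m, hmC₁, by rw [inv_mul_cancel_right]⟩
    refine (mem_heisBall_two_iff σ hσ hσv hτ hu hC hB _).2 ⟨mul_mem hgC (inv_mem hmC), ?_, ?_⟩ <;>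
      rw [Units.val_mul, hg, hm'] <;> simp [Matrix.mul_apply, Matrix.diagonal, hα0, hβ0]
  -- STEP A: `[C : dCd⁻¹] = [B : B₂] = [B : B₁] · [B₁ : B₂]`
  have hA : C₁.relIndex C = B₂.relIndex B₁ * B₁.relIndex B := by
    rw [relIndex_eq_relIndex_of_coe_subset_mul hBC hcover, ← Subgroup.inf_relIndex_right C₁ B, hinf, Subgroup.relIndex_mul_relIndex B₂ B₁ B hB₂B₁ hB₁B]
  -- STEP X: `[B(v2,v2) : B(v2·vt, v2)] = [2𝒪 : 2t𝒪] = [𝒪 : t𝒪]` through `g ↦ g₀₁`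
  have hX : B₁.relIndex B = (O.map (AddMonoidHom.mulLeft t)).relIndex O := by
    let φ : ↥B →* Multiplicative K :=
      { toFun := fun g => Multiplicative.ofAdd (((g : GL (Fin 3) K) : Matrix (Fin 3) (Fin 3) K) 0 1)
        map_one' := by rw [OneMemClass.coe_one, Units.val_one]; simp
        map_mul' := by
          intro g g'
          obtain ⟨x, z, -, -, -, hg⟩ := (hB g).1 g.2
          obtain ⟨x', z', -, -, -, hg'⟩ := (hB g').1 g'.2
          rw [← ofAdd_add, Subgroup.coe_mul, coe_heis_mul σ hg hg', hg, hg', e01, e01, e01] }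
    have hφ : ∀ g : ↥B, φ g = Multiplicative.ofAdd (((g : GL (Fin 3) K) : Matrix (Fin 3) (Fin 3) K) 0 1) := fun g => rfl
    have hrange : φ.range = AddSubgroup.toSubgroup (O.map (AddMonoidHom.mulLeft (2 : K))) := by
      ext y
      rw [MonoidHom.mem_range]
      change _ ↔ Multiplicative.toAdd y ∈ O.map (AddMonoidHom.mulLeft (2 : K))
      rw [mem_map_mulLeft_iff hO h2]
      constructor
      · rintro ⟨g, rfl⟩
        obtain ⟨x, z, -, hvx, -, hg⟩ := (hB g).1 g.2
        rw [hφ, toAdd_ofAdd, hg, e01]; exact hvx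
      · intro hvy
        set y' := Multiplicative.toAdd y with hy'
        obtain ⟨n, hn, -⟩ := exists_units_coe_eq_upperTriangularUnipotent y' (-(y' * σ y' / 2)) (-σ y')
        have hrel' : -(y' * σ y' / 2) + σ (-(y' * σ y' / 2)) + y' * σ y' = 0 := by
          rw [map_neg, map_div₀, map_mul, hσ, hσ2]; field_simp; ring
        have hvz' : Valued.v (-(y' * σ y' / 2)) ≤ Valued.v (2 : K) := by
          rw [Valuation.map_neg]
          have h := @hhalf y' y' 1 1 (by rw [mul_one]; exact hvy) (by rw [mul_one]; exact hvy)
          rwa [mul_one, mul_one] at h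
        have hnB : n ∈ B := (hB n).2 ⟨y', -(y' * σ y' / 2), hrel', hvy, hvz', hn⟩
        exact ⟨⟨n, hnB⟩, by rw [hφ]; change Multiplicative.ofAdd ((n : Matrix (Fin 3) (Fin 3) K) 0 1) = y; rw [hn, e01, hy', ofAdd_toAdd]⟩
    have hcomap : B₁.subgroupOf B = (AddSubgroup.toSubgroup ((O.map (AddMonoidHom.mulLeft t)).map (AddMonoidHom.mulLeft (2 : K)))).comap φ := by
      ext g
      rw [Subgroup.mem_subgroupOf, Subgroup.mem_comap]
      change _ ↔ Multiplicative.toAdd (φ g) ∈ (O.map (AddMonoidHom.mulLeft t)).map (AddMonoidHom.mulLeft (2 : K))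
      rw [mem_map_map_mulLeft_iff hO h2 ht, hφ, toAdd_ofAdd]
      obtain ⟨x, z, hrel, hvx, hvz, hg⟩ := (hB g).1 g.2
      have hx01 : ((g : GL (Fin 3) K) : Matrix (Fin 3) (Fin 3) K) 0 1 = x := by rw [hg, e01]
      rw [hB₁, hx01]
      constructor
      · rintro ⟨x₁, z₁, -, hvx₁, -, hg₁⟩
        have h01 := congrArg (fun M : Matrix (Fin 3) (Fin 3) K => M 0 1) (hg.symm.trans hg₁)
        simp only [e01] at h01
        rwa [h01]
      · intro hvxt; exact ⟨x, z, hrel, hvxt, hvz, hg⟩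
    rw [Subgroup.relIndex, hcomap, Subgroup.index_comap, hrange, AddSubgroup.relIndex_toSubgroup,
      AddSubgroup.relIndex_map_map_of_injective _ _ hinj2]
  -- STEP Z: `[B(v2·vt, v2) : B(v2·vt, v2·vt²)] = [2𝒪⁻ : 2t²𝒪⁻] = [𝒪⁻ : t²𝒪⁻]` through `g ↦ g₀₂ mod 2t²𝒪`
  have hZ : B₂.relIndex B₁ = (Om.map (AddMonoidHom.mulLeft (t * t))).relIndex Om := by
    set T : AddSubgroup K := (O.map (AddMonoidHom.mulLeft (t * t))).map (AddMonoidHom.mulLeft (2 : K)) with hTdef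
    have hT : ∀ y : K, y ∈ T ↔ Valued.v y ≤ Valued.v (2 : K) * (Valued.v t * Valued.v t) := fun y => by
      rw [hTdef, mem_map_map_mulLeft_iff hO h2 htt, Valuation.map_mul]
    set Om₂ : AddSubgroup K := Om.map (AddMonoidHom.mulLeft (2 : K)) with hOm₂def
    have hOm₂ : ∀ y : K, y ∈ Om₂ ↔ σ y = -y ∧ Valued.v y ≤ Valued.v (2 : K) := fun y => by rw [hOm₂def]; exact mem_map_mulLeft_two_skew_iff σ hO hOm h2 y
    let π : K →+ K ⧸ T := QuotientAddGroup.mk' T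
    have hπ : ∀ a b : K, π a = π b ↔ b - a ∈ T := fun a b => by
      rw [QuotientAddGroup.mk'_apply, QuotientAddGroup.mk'_apply, QuotientAddGroup.eq, neg_add_eq_sub]
    let φ : ↥B₁ →* Multiplicative (K ⧸ T) :=
      { toFun := fun g => Multiplicative.ofAdd (π (((g : GL (Fin 3) K) : Matrix (Fin 3) (Fin 3) K) 0 2))
        map_one' := by rw [OneMemClass.coe_one, Units.val_one]; simp
        map_mul' := by
          intro g g'
          obtain ⟨x, z, -, hvx, -, hg⟩ := (hB₁ g).1 g.2
          obtain ⟨x', z', -, hvx', -, hg'⟩ := (hB₁ g').1 g'.2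
          rw [← ofAdd_add, Subgroup.coe_mul, coe_heis_mul σ hg hg', hg, hg', e02, e02, e02, ← map_add]
          congr 1
          rw [hπ]
          refine (hT _).2 ?_
          rw [show z + z' - (z + z' - x * σ x') = x * σ x' by ring, Valuation.map_mul, hσv]
          calc Valued.v x * Valued.v x' ≤ Valued.v (2 : K) * Valued.v t * (Valued.v (2 : K) * Valued.v t) := mul_le_mul' hvx hvx'
            _ = Valued.v (2 : K) * (Valued.v (2 : K) * (Valued.v t * Valued.v t)) := by simp only [mul_comm, mul_left_comm]
            _ ≤ 1 * (Valued.v (2 : K) * (Valued.v t * Valued.v t)) := mul_le_mul' h2le le_rfl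
            _ = Valued.v (2 : K) * (Valued.v t * Valued.v t) := one_mul _ }
    have hφ : ∀ g : ↥B₁, φ g = Multiplicative.ofAdd (π (((g : GL (Fin 3) K) : Matrix (Fin 3) (Fin 3) K) 0 2)) := fun g => rfl
    -- kernel
    have hker : φ.ker = B₂.subgroupOf B₁ := by
      ext g
      rw [MonoidHom.mem_ker, Subgroup.mem_subgroupOf, hφ, ← ofAdd_zero, Multiplicative.ofAdd.apply_eq_iff_eq, ← map_zero π, hπ, zero_sub, neg_mem_iff, hT]
      obtain ⟨x, z, hrel, hvx, hvz, hg⟩ := (hB₁ g).1 g.2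
      have hz02 : ((g : GL (Fin 3) K) : Matrix (Fin 3) (Fin 3) K) 0 2 = z := by rw [hg, e02]
      rw [hB₂, hz02]
      constructor
      · intro hvztt; exact ⟨x, z, hrel, hvx, hvztt, hg⟩
      · rintro ⟨x₁, z₁, -, -, hvz₁, hg₁⟩
        have h02 := congrArg (fun M : Matrix (Fin 3) (Fin 3) K => M 0 2) (hg.symm.trans hg₁)
        simp only [e02] at h02
        rwa [h02]
    -- range
    let ψ : ↥Om₂ →+ K ⧸ T := π.comp Om₂.subtype
    have hψker : ψ.ker = T.addSubgroupOf Om₂ := by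
      ext o
      rw [AddMonoidHom.mem_ker, AddSubgroup.mem_addSubgroupOf, AddMonoidHom.comp_apply, AddSubgroup.coe_subtype, QuotientAddGroup.mk'_apply,
        QuotientAddGroup.eq_zero_iff]
    have hrange : Set.range φ = Multiplicative.ofAdd '' Set.range ψ := by
      ext y
      simp only [Set.mem_range, Set.mem_image]
      constructor
      · rintro ⟨g, rfl⟩
        obtain ⟨x, z, hrel, hvx, hvz, hg⟩ := (hB₁ g).1 g.2
        have hxx : Valued.v (x * σ x / 2) ≤ Valued.v (2 : K) * (Valued.v t * Valued.v t) := hhalf hvx hvx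
        have ho : σ (z + x * σ x / 2) = -(z + x * σ x / 2) ∧ Valued.v (z + x * σ x / 2) ≤ Valued.v (2 : K) := by
          refine ⟨?_, (Valuation.map_add _ _ _).trans (max_le hvz (hxx.trans (mul_le_of_le_one_right' (by rw [← Valuation.map_mul]; exact hvtt))))⟩
          rw [map_add, map_div₀, map_mul, hσ, hσ2]; field_simp; linear_combination (2 : K) * hrel
        refine ⟨ψ ⟨z + x * σ x / 2, (hOm₂ _).2 ho⟩, ⟨_, rfl⟩, ?_⟩
        rw [hφ, hg, e02]
        congr 1
        rw [AddMonoidHom.comp_apply, AddSubgroup.coe_subtype, hπ]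
        refine (hT _).2 ?_
        rw [show z - (z + x * σ x / 2) = -(x * σ x / 2) by ring, Valuation.map_neg]
        exact hxx
      · rintro ⟨_, ⟨o, rfl⟩, rfl⟩
        obtain ⟨hσo, hvo⟩ := (hOm₂ o).1 o.2
        obtain ⟨n, hn, -⟩ := exists_units_coe_eq_upperTriangularUnipotent (0 : K) (o : K) (-σ 0)
        have hnB₁ : n ∈ B₁ := (hB₁ n).2 ⟨0, o, by rw [hσo, map_zero, mul_zero, add_zero, add_neg_cancel], by rw [map_zero]; exact zero_le, hvo, hn⟩
        exact ⟨⟨n, hnB₁⟩, by rw [hφ]; change Multiplicative.ofAdd (π ((n : Matrix (Fin 3) (Fin 3) K) 0 2)) = _; rw [hn, e02]; rfl⟩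
    have hcard : Nat.card φ.range = Nat.card ψ.range := by
      rw [← SetLike.coe_sort_coe φ.range, ← SetLike.coe_sort_coe ψ.range, MonoidHom.coe_range, AddMonoidHom.coe_range, hrange]
      exact Nat.card_image_of_injective Multiplicative.ofAdd.injective _
    rw [Subgroup.relIndex, ← hker, Subgroup.index_ker, hcard, ← AddSubgroup.index_ker, hψker]
    change T.relIndex Om₂ = _
    rw [← AddSubgroup.inf_relIndex_right T Om₂, hTdef, hOm₂def, ← AddSubgroup.map_inf _ _ _ hinj2, ← map_mulLeft_skew_eq_inf σ hO hOm htt hσtt hvtt,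
      AddSubgroup.relIndex_map_map_of_injective _ _ hinj2]
  rw [hA, hX, hZ, mul_comm]

/-- **THE LEVEL-2 COUNT IN THE LINE LEAD'S LETTERS: `[C₂ : d(t) C₂ d(t)⁻¹] = Q²`** once the INDEX BRIDGES supply `[𝒪 : t𝒪] = Q` (`hF1`) and `[𝒪⁻ : t²𝒪⁻] = Q` (`hF⁻`)
(K2E3-p21 (g2), ★ `K2E3LocalLatticeScalingIndex`); `a(transvection) = 2`; no hypothesis on `v 2` beyond `2 ≠ 0`. [cite: Rogawski1990, §8.1 Prop. 8.1.2 (b) p. 114]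
[cite: HarishChandra1999AdmissibleDistributions, §3.1 Lemma 3.2] -/
theorem relIndex_map_conj_torus_levelTwo_eq_sq (hσ : ∀ a : K, σ (σ a) = a) (hσv : ∀ a : K, Valued.v (σ a) = Valued.v a) (h2 : (2 : K) ≠ 0)
    {τ t : K} (hτ : τ ≠ 0) (ht : t ≠ 0) (hσt : σ t = t) (hvt : Valued.v t ≤ 1)
    {u d : GL (Fin 3) K} (hu : (u : Matrix (Fin 3) (Fin 3) K) = !![1, 0, τ; 0, 1, 0; 0, 0, 1])
    (hd : (d : Matrix (Fin 3) (Fin 3) K) = Matrix.diagonal ![t, 1, (σ t)⁻¹]) (hd' : ((d⁻¹ : GL (Fin 3) K) : Matrix (Fin 3) (Fin 3) K) = Matrix.diagonal ![t⁻¹, 1, σ t])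
    {C : Subgroup (GL (Fin 3) K)} (hC : ∀ g : GL (Fin 3) K, g ∈ C ↔ g ∈ unitaryGroupOfForm σ ((StdForm.antidiagonal 3).over K) ∧ g * u = u * g ∧
      (∀ i j : Fin 3, Valued.v (((g : Matrix (Fin 3) (Fin 3) K) - 1) i j) ≤ Valued.v (2 : K)) ∧
      (∀ i j : Fin 3, Valued.v ((((g⁻¹ : GL (Fin 3) K) : Matrix (Fin 3) (Fin 3) K) - 1) i j) ≤ Valued.v (2 : K)))
    {O : AddSubgroup K} (hO : ∀ x : K, x ∈ O ↔ Valued.v x ≤ 1) {Om : AddSubgroup K} (hOm : ∀ x : K, x ∈ Om ↔ σ x = -x ∧ Valued.v x ≤ 1)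
    {Q : ℕ} (hF1 : (O.map (AddMonoidHom.mulLeft t)).relIndex O = Q) (hFm : (Om.map (AddMonoidHom.mulLeft (t * t))).relIndex Om = Q) :
    (C.map (MulAut.conj d).toMonoidHom).relIndex C = Q ^ 2 := by
  rw [relIndex_map_conj_torus_levelTwo σ hσ hσv h2 hτ ht hσt hvt hu hd hd' hC hO hOm, hF1, hFm, pow_two]

end Summit.HodgeConjecture.HodgeConjecture.Cruxes.H413.K2E3TransvectionCentralizerLevelTwoIndex

end
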